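import Summits.KontsevichZagierPeriods.KontsevichZagierPeriods.Theorems.PlanarAreas.Negative.Normalisations
import Summits.KontsevichZagierPeriods.KontsevichZagierPeriods.Theorems.PlanarAreas.Negative.Rule2LoadBearing
import Literature.NumberTheory.Transcendental.KZSemiCanonicalReductionProofs
import Literature.MeasureTheory.Lebesgue.PolynomialZeroSet

/-!
# `PlanarAreas` (stmt-KontsevichZagierPeriods-4990): negative side — VII. tightness of the rule-2 witness

The witness pair of `Rule2LoadBearing.not_withoutRule2` — the hyperbola region `R = {1<x<2, 0<y<1/x}`
and its translate `R + (3,0)` — IS equivalent in the full calculus (`hypRep_equivalent_hypShiftRep`):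
null algebraic arcs are discarded by rule 1a (`equivalent_of_null_diff`), one Newton–Leibniz move
lands on the shadow `[(1,2), 1/x]` (`KZ.exists_underGraph`), the dimension-1 TRANSLATION `x ↦ x + 3`
is ONE change-of-variables instance (`of_invShiftRep_zero_sub_three_mem`), and back.  So the pair
is no counterexample to the crux: `not_withoutRule2` pins the blame exactly on the absence of
rule 2.

REPAIR 2026-08-19 (cell pub-kz1p, seat b2b-kz1p-1; ONE identifier removed from an `open … (…)` list, NO statement,
proof or declaration changed): the explicit open list below named `PlanarTransport`, dropped from
`Theses/SymplecticScissors.lean` by the items-cap lint autofix of 2026-08-16T14:16:23Z and unused in this file; with it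
the module did not elaborate at HEAD (same repair as `Core.lean`). -/

noncomputable section

open Set MeasureTheory MvPolynomial Filter Topology
open Literature.NumberTheory.Transcendental Literature.ModelTheory.ExponentialFields

namespace Summit.KontsevichZagierPeriods.PlanarAreas.Negative

open Summit.KontsevichZagierPeriods.KontsevichZagierPeriods.Theses.SymplecticScissors
  (PlanarAreas VolumeForm PlanarK0Injective GroupToAreas)

/-! ## §3d Tightness of §3c: the witness pair IS equivalent in the full calculus

`[R] ~ [R + (3,0)]` by five moves: domain additivity against null algebraic arcs, one
Newton–Leibniz move onto the shadow `[(1,2), 1/x]` (`KZ.exists_underGraph`), the dimension-1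
TRANSLATION `x ↦ x + 3` (the one rule-2 move), and back.  So the §3c pair is no counterexample to
the crux; it only shows that its rule-2 move cannot be traded for rules 1a/1b/3. -/

/-- **Null differences do not matter**: two integrand-`1` planar representations whose domains
differ by null sets are equivalent (rule 1a twice, null regions being relations). -/
theorem equivalent_of_null_diff (r r' : KZ.IntegralRep 2) (hr : ∀ p ∈ r.domain, r.integrand p = 1)
    (hr' : ∀ p ∈ r'.domain, r'.integrand p = 1) (h₁ : volume (r.domain \ r'.domain) = 0)
    (h₂ : volume (r'.domain \ r.domain) = 0) : KZ.Equivalent r r' := by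
  have hσ := r.isSemialgebraic_domain
  have hσ' := r'.isSemialgebraic_domain
  have hfin := volume_lt_top_of_integrand_one r hr
  let i : KZ.IntegralRep 2 := constOneRep (r.domain ∩ r'.domain) (hσ.inter hσ')
    (lt_top_iff_ne_top.mp ((measure_mono inter_subset_left).trans_lt hfin))
  let d : KZ.IntegralRep 2 := constOneRep (r.domain \ r'.domain) (hσ.diff hσ')
    (by rw [h₁]; exact ENNReal.zero_ne_top)
  let d' : KZ.IntegralRep 2 := constOneRep (r'.domain \ r.domain) (hσ'.diff hσ)
    (by rw [h₂]; exact ENNReal.zero_ne_top)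
  have ha : KZ.of r - KZ.of i - KZ.of d ∈ KZ.relations := by
    refine KZ.domainAddRel_subset_relations ⟨2, r, i, d, ?_, ?_, ?_, ?_, rfl⟩
    · simp [i, d]
    · simp [i, d]
      rw [show r.domain ∩ r'.domain ∩ (r.domain \ r'.domain) = ∅ by
        ext x; simp only [mem_inter_iff, Set.mem_sdiff, mem_empty_iff_false, iff_false]; tauto]
      exact measure_empty
    · intro x hx; exact hr x hx.1
    · intro x hx; exact hr x hx.1
  have ha' : KZ.of r' - KZ.of i - KZ.of d' ∈ KZ.relations := by
    refine KZ.domainAddRel_subset_relations ⟨2, r', i, d', ?_, ?_, ?_, ?_, rfl⟩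
    · simp only [i, d', constOneRep_domain]
      rw [inter_comm, inter_union_sdiff]
    · simp only [i, d', constOneRep_domain]
      rw [show r.domain ∩ r'.domain ∩ (r'.domain \ r.domain) = ∅ by
        ext x; simp only [mem_inter_iff, Set.mem_sdiff, mem_empty_iff_false, iff_false]; tauto]
      exact measure_empty
    · intro x hx; exact hr' x hx.2
    · intro x hx; exact hr' x hx.1
  have hd : KZ.of d ∈ KZ.relations := of_mem_relations_of_volume_eq_zero d h₁
  have hd' : KZ.of d' ∈ KZ.relations := of_mem_relations_of_volume_eq_zero d' h₂
  have : KZ.of r - KZ.of r' =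
      (KZ.of r - KZ.of i - KZ.of d) - (KZ.of r' - KZ.of i - KZ.of d') + KZ.of d - KZ.of d' := by
    abel
  show KZ.of r - KZ.of r' ∈ KZ.relations
  rw [this]
  exact KZ.relations.sub_mem (KZ.relations.add_mem (KZ.relations.sub_mem ha ha') hd) hd'

/-- The interval `(a, b)` as a subset of `ℝ¹` is `ℚ`-semialgebraic for rational `a, b`. -/
theorem isSemialgebraic_setOf_apply_mem_Ioo (a b : ℚ) :
    IsSemialgebraic ℚ {x : Fin 1 → ℝ | x 0 ∈ Ioo (a:ℝ) b} := by
  have h0 := isSemialgebraic_setOf_eval_lt (k := ℚ) (R := ℝ) (ι := Fin 1) (C a) (X 0)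
  have h1 := isSemialgebraic_setOf_eval_lt (k := ℚ) (R := ℝ) (ι := Fin 1) (X 0) (C b)
  have hEq : {x : Fin 1 → ℝ | x 0 ∈ Ioo (a:ℝ) b} =
      {x : Fin 1 → ℝ | aeval x (C a : MvPolynomial (Fin 1) ℚ) < aeval x (X 0 : MvPolynomial (Fin 1) ℚ)} ∩
      {x : Fin 1 → ℝ | aeval x (X 0 : MvPolynomial (Fin 1) ℚ) < aeval x (C b : MvPolynomial (Fin 1) ℚ)} := by
    ext x
    simp
  rw [hEq]
  exact h0.inter h1

/-- The Newton–Leibniz shadow of `R + (c, 0)`: `[(1 + c, 2 + c), 1/(x − c)]` for rational `c`. -/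
def invShiftRep (c : ℚ) : KZ.IntegralRep 1 where
  domain := {x | x 0 ∈ Ioo ((1:ℝ) + c) (2 + c)}
  integrand := fun x : Fin 1 → ℝ => (x 0 - (c:ℝ))⁻¹
  isSemialgebraic_domain := by
    simpa [Rat.cast_add, Rat.cast_one, Rat.cast_ofNat] using isSemialgebraic_setOf_apply_mem_Ioo (1 + c) (2 + c)
  isSemialgebraicFunOn_integrand := by
    have hs : IsSemialgebraic ℚ {x : Fin 1 → ℝ | x 0 ∈ Ioo ((1:ℝ) + c) (2 + c)} := by
      simpa [Rat.cast_add, Rat.cast_one, Rat.cast_ofNat] using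
        isSemialgebraic_setOf_apply_mem_Ioo (1 + c) (2 + c)
    have hq : ∀ x ∈ {x : Fin 1 → ℝ | x 0 ∈ Ioo ((1:ℝ) + c) (2 + c)},
        aeval x (X 0 - C c : MvPolynomial (Fin 1) ℚ) ≠ 0 := by
      intro x hx
      have : (1:ℝ) + c < x 0 := hx.1
      simp only [map_sub, MvPolynomial.aeval_X, MvPolynomial.aeval_C, eq_ratCast]
      linarith
    refine (isSemialgebraicFunOn_aeval_div_aeval hs (C 1) (X 0 - C c) hq).congr fun x _ => ?_
    simp [one_div]
  integrableOn := by
    have hsub : {x : Fin 1 → ℝ | x 0 ∈ Ioo ((1:ℝ) + c) (2 + c)} ⊆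
        Icc (fun _ : Fin 1 => (1:ℝ) + c) (fun _ => 2 + c) := by
      intro x hx
      rw [mem_Icc, Pi.le_def, Pi.le_def]
      refine ⟨fun i => ?_, fun i => ?_⟩
      · have hi : i = 0 := Fin.ext (by have := i.isLt; omega)
        rw [hi]; exact hx.1.le
      · have hi : i = 0 := Fin.ext (by have := i.isLt; omega)
        rw [hi]; exact hx.2.le
    have hcont : ContinuousOn (fun x : Fin 1 → ℝ => (x 0 - c)⁻¹)
        (Icc (fun _ : Fin 1 => (1:ℝ) + c) (fun _ => 2 + c)) := by
      refine ContinuousOn.inv₀ (((continuous_apply 0).sub continuous_const).continuousOn)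
        fun x hx => ?_
      have : (1:ℝ) + c ≤ x 0 := hx.1 0
      exact ne_of_gt (by linarith)
    exact (hcont.integrableOn_compact isCompact_Icc).mono_set hsub

/-- The domain of `invShiftRep c`. -/
@[simp] theorem invShiftRep_domain (c : ℚ) :
    (invShiftRep c).domain = {x | x 0 ∈ Ioo ((1:ℝ) + c) (2 + c)} := rfl

/-- The integrand of `invShiftRep c`. -/
@[simp] theorem invShiftRep_integrand (c : ℚ) :
    (invShiftRep c).integrand = fun x : Fin 1 → ℝ => (x 0 - (c:ℝ))⁻¹ := rfl

/-- **The one rule-2 move**: the shadows of `R` and `R + (3,0)` differ by the dimension-1 translation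
`x ↦ x + 3` (one change-of-variables instance). -/
theorem of_invShiftRep_zero_sub_three_mem :
    KZ.of (invShiftRep 0) - KZ.of (invShiftRep 3) ∈ KZ.changeOfVariablesRel := by
  refine ⟨1, invShiftRep 0, invShiftRep 3, fun x => fun i => x i + 3,
    fun _ => ContinuousLinearMap.id ℝ (Fin 1 → ℝ), ?_, ?_, ?_, ?_, ?_, rfl⟩
  · have := isSemialgebraicMapOn_aeval (k := ℚ) (R := ℝ) (invShiftRep 0).isSemialgebraic_domain
      (fun _ : Fin 1 => (X 0 + C 3 : MvPolynomial (Fin 1) ℚ))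
    convert this using 2 with x
    funext i
    have hi : i = 0 := Fin.ext (by have := i.isLt; omega)
    simp [hi]
  · intro x _
    have h : HasFDerivWithinAt (fun x : Fin 1 → ℝ => x + fun _ => (3:ℝ))
        (ContinuousLinearMap.id ℝ (Fin 1 → ℝ)) (invShiftRep 0).domain x :=
      (hasFDerivWithinAt_id x _).add_const _
    convert h using 1
    funext y i
    rfl
  · intro x _ y _ hxy
    funext i
    have := congrFun hxy i
    simpa using this
  · ext y
    simp only [invShiftRep_domain, mem_setOf_eq, mem_image, mem_Ioo, Rat.cast_zero, add_zero,
      Rat.cast_ofNat]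
    constructor
    · rintro ⟨h1, h2⟩
      refine ⟨fun i => y i - 3, ⟨by linarith, by linarith⟩, ?_⟩
      funext i
      ring
    · rintro ⟨x, ⟨h1, h2⟩, rfl⟩
      constructor <;> linarith
  · intro x _
    simp only [invShiftRep_integrand, Rat.cast_zero, sub_zero, Rat.cast_ofNat, add_sub_cancel_right,
      ContinuousLinearMap.det, ContinuousLinearMap.coe_id, LinearMap.det_id, abs_one, mul_one]

/-- **Tightness of §3c**: the hyperbola region and its translate ARE equivalent in the full
calculus (so `not_withoutRule2` pins the blame on the absence of rule 2, not on the pair). -/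
theorem hypRep_equivalent_hypShiftRep : KZ.Equivalent hypRep hypShiftRep := by
  -- the two shadows and their under-graphs
  have h0 : ∀ x ∈ (invShiftRep 0).domain, 0 ≤ (invShiftRep 0).integrand x := by
    intro x hx
    have : (1:ℝ) + (0:ℚ) < x 0 := hx.1
    simp only [invShiftRep_integrand, Rat.cast_zero, sub_zero, inv_nonneg]
    push_cast at this
    linarith
  have h3 : ∀ x ∈ (invShiftRep 3).domain, 0 ≤ (invShiftRep 3).integrand x := by
    intro x hx
    have : (1:ℝ) + (3:ℚ) < x 0 := hx.1
    simp only [invShiftRep_integrand, Rat.cast_ofNat, inv_nonneg]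
    push_cast at this
    linarith
  obtain ⟨G, hGd, hGi, hG⟩ := KZ.exists_underGraph (invShiftRep 0) h0
  obtain ⟨G', hGd', hGi', hG'⟩ := KZ.exists_underGraph (invShiftRep 3) h3
  have hGr : KZ.Equivalent G (invShiftRep 0) := KZ.newtonLeibnizRel_subset_relations hG
  have hGr' : KZ.Equivalent G' (invShiftRep 3) := KZ.newtonLeibnizRel_subset_relations hG'
  have hrr' : KZ.Equivalent (invShiftRep 0) (invShiftRep 3) :=
    KZ.changeOfVariablesRel_subset_relations of_invShiftRep_zero_sub_three_mem
  -- membership in the under-graphs, unfolded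
  have hmemG : ∀ p : Fin 2 → ℝ, p ∈ G.domain ↔ p 0 ∈ Ioo (1:ℝ) 2 ∧ 0 ≤ p 1 ∧ p 1 ≤ (p 0)⁻¹ := by
    intro p
    rw [hGd]
    show (Fin.init p ∈ {x : Fin 1 → ℝ | x 0 ∈ Ioo ((1:ℝ) + (0:ℚ)) (2 + (0:ℚ))} ∧
      (0:ℝ) ≤ p (Fin.last 1) ∧ p (Fin.last 1) ≤ (Fin.init p 0 - ((0:ℚ) : ℝ))⁻¹) ↔ _
    simp only [mem_setOf_eq, Rat.cast_zero, add_zero, sub_zero]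
    rfl
  have hmemG' : ∀ p : Fin 2 → ℝ, p ∈ G'.domain ↔ p 0 ∈ Ioo (4:ℝ) 5 ∧ 0 ≤ p 1 ∧ p 1 ≤ (p 0 - 3)⁻¹ := by
    intro p
    rw [hGd']
    show (Fin.init p ∈ {x : Fin 1 → ℝ | x 0 ∈ Ioo ((1:ℝ) + (3:ℚ)) (2 + (3:ℚ))} ∧
      (0:ℝ) ≤ p (Fin.last 1) ∧ p (Fin.last 1) ≤ (Fin.init p 0 - ((3:ℚ) : ℝ))⁻¹) ↔ _
    simp only [mem_setOf_eq, Rat.cast_ofNat]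
    norm_num
    rfl
  -- null algebraic arcs
  have hnull1 : volume {p : Fin 2 → ℝ | p 1 = 0} = 0 := by
    have := MvPolynomial.volume_zeroSet_eq_zero 2 (X 1) (X_ne_zero 1)
    simpa using this
  have hnull2 : volume {p : Fin 2 → ℝ | p 0 * p 1 = 1} = 0 := by
    have hne : (X 0 * X 1 - 1 : MvPolynomial (Fin 2) ℝ) ≠ 0 := by
      intro h
      have := congrArg (MvPolynomial.eval (fun _ : Fin 2 => (0:ℝ))) h
      simp at this
    have := MvPolynomial.volume_zeroSet_eq_zero 2 (X 0 * X 1 - 1) hne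
    simpa [sub_eq_zero] using this
  have hnull3 : volume {p : Fin 2 → ℝ | (p 0 - 3) * p 1 = 1} = 0 := by
    have hne : ((X 0 - 3) * X 1 - 1 : MvPolynomial (Fin 2) ℝ) ≠ 0 := by
      intro h
      have := congrArg (MvPolynomial.eval (fun _ : Fin 2 => (0:ℝ))) h
      simp at this
    have := MvPolynomial.volume_zeroSet_eq_zero 2 ((X 0 - 3) * X 1 - 1) hne
    simpa [sub_eq_zero] using this
  -- `R ~ G`
  have hRG : KZ.Equivalent hypRep G := by
    refine equivalent_of_null_diff hypRep G (fun _ _ => rfl) (fun p _ => by rw [hGi]) ?_ ?_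
    · rw [show hypRep.domain \ G.domain = ∅ by
        ext p
        simp only [mem_empty_iff_false, iff_false]
        intro hp
        rw [Set.mem_sdiff, hmemG, hypRep_domain] at hp
        have hp1 : 1 < p 0 ∧ p 0 < 2 ∧ 0 < p 1 ∧ p 0 * p 1 < 1 := hp.1
        obtain ⟨h1, h2, h3, h4⟩ := hp1
        have h0 : 0 < p 0 := by linarith
        refine hp.2 ⟨⟨h1, h2⟩, h3.le, ?_⟩
        rw [← one_div, le_div_iff₀ h0]
        linarith [mul_comm (p 0) (p 1)]]
      exact measure_empty
    · refine measure_mono_null (fun p hp => ?_) (measure_union_null hnull1 hnull2)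
      rw [Set.mem_sdiff, hmemG, hypRep_domain] at hp
      obtain ⟨⟨⟨h1, h2⟩, h3, h4⟩, hn⟩ := hp
      replace hn : ¬ (1 < p 0 ∧ p 0 < 2 ∧ 0 < p 1 ∧ p 0 * p 1 < 1) := hn
      have h0 : 0 < p 0 := by linarith
      simp only [mem_union, mem_setOf_eq]
      by_contra hcon
      simp only [not_or] at hcon
      apply hn
      refine ⟨h1, h2, lt_of_le_of_ne h3 (Ne.symm hcon.1), ?_⟩
      rw [← one_div, le_div_iff₀ h0] at h4
      exact lt_of_le_of_ne (by linarith [mul_comm (p 0) (p 1)]) hcon.2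
  -- `R + (3,0) ~ G'`
  have hRG' : KZ.Equivalent hypShiftRep G' := by
    refine equivalent_of_null_diff hypShiftRep G' (fun _ _ => rfl) (fun p _ => by rw [hGi']) ?_ ?_
    · rw [show hypShiftRep.domain \ G'.domain = ∅ by
        ext p
        simp only [mem_empty_iff_false, iff_false]
        intro hp
        rw [Set.mem_sdiff, hmemG', hypShiftRep_domain] at hp
        have hp1 : 4 < p 0 ∧ p 0 < 5 ∧ 0 < p 1 ∧ (p 0 - 3) * p 1 < 1 := hp.1
        obtain ⟨h1, h2, h3, h4⟩ := hp1
        have h0 : 0 < p 0 - 3 := by linarith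
        refine hp.2 ⟨⟨h1, h2⟩, h3.le, ?_⟩
        rw [← one_div, le_div_iff₀ h0]
        linarith [mul_comm (p 0 - 3) (p 1)]]
      exact measure_empty
    · refine measure_mono_null (fun p hp => ?_) (measure_union_null hnull1 hnull3)
      rw [Set.mem_sdiff, hmemG', hypShiftRep_domain] at hp
      obtain ⟨⟨⟨h1, h2⟩, h3, h4⟩, hn⟩ := hp
      replace hn : ¬ (4 < p 0 ∧ p 0 < 5 ∧ 0 < p 1 ∧ (p 0 - 3) * p 1 < 1) := hn
      have h0 : 0 < p 0 - 3 := by linarith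
      simp only [mem_union, mem_setOf_eq]
      by_contra hcon
      simp only [not_or] at hcon
      apply hn
      refine ⟨h1, h2, lt_of_le_of_ne h3 (Ne.symm hcon.1), ?_⟩
      rw [← one_div, le_div_iff₀ h0] at h4
      exact lt_of_le_of_ne (by linarith [mul_comm (p 0 - 3) (p 1)]) hcon.2
  exact ((hRG.trans hGr).trans hrr').trans (hRG'.trans hGr').symm

end Summit.KontsevichZagierPeriods.PlanarAreas.Negative

end
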